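import Summits.AtomisticToContinuum.HydrodynamicLimit.Theorems.CollisionIsometryCLTAdaptedWeightCLTBlockHDissipation
import Summits.AtomisticToContinuum.HydrodynamicLimit.Theorems.CollisionIsometryCLTAdaptedWeightCLTCBPathwiseBudget

/-!
# Entropy budget (stub `stub_entropyBudget`, line `block-h-dissipation-closure`, crux `AdaptedWeightCLT`,
stmt-AtomisticToContinuum-14868; `--supports`) — helper 12: EXACT TELESCOPING of a configuration functional
along a hard-sphere trajectory (mechanism (i) of the stub, trajectory part)

For ANY functional `E : Cfg N → ℝ` that is differentiable along every free flight
(`r ↦ E(freeFlight r w)` differentiable everywhere, with a time-uniform bounded derivative for each start),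
and every hard-sphere trajectory `γ` in the torus geometry at a diameter `< 1/2`:
`Σ_{collisions in (0,t]} (E(pre) − E(post)) + E(γ t) − E(γ 0) = ∫₀ᵗ d/dr|₀ E(freeFlight r (γ s)) ds`,
the sum being the collision pair sum of `E(collidePair i j (γ s)) − E(γ s)` over `i < j` (pre-collisional
configuration through the elastic involution, `leftLim_eq_collidePair`, `contactPairs_eq_pair`). ONE STRETCH: on
a collision-free `(a, b)` the curve is the free flight of `γ a` (`eq_freeFlight_of_Ioo_free`,
`leftLim_eq_freeFlight`), the integrand is `(E ∘ freeFlight · (γ a))' (s − a)` there (group property, no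
differentiability needed for `deriv`), and the fundamental theorem of calculus applies
(`integral_eq_sub_of_hasDerivAt`; the derivative is bounded and Borel, hence interval integrable);
TELESCOPING: strong induction on the number of collision times in `(0, t)` exactly as the landed
`ContactBalance.PathwiseBudget.budget`, carrying interval integrability along.
-/

namespace Summit.AtomisticToContinuum.HydrodynamicLimit.Theorems.BlockHDissipation

open scoped BigOperators Topology Classical MeasureTheory ENNReal InnerProductSpace
open Filter Set MeasureTheory
open Literature.Analysis.FluidPDE
open Summit.AtomisticToContinuum.HydrodynamicLimit.Theorems.ContactSourceDuhamel (T3 V3 Cfg Vel Flow Flows)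
open Summit.AtomisticToContinuum.HydrodynamicLimit.Theorems.ContactSourceDuhamel.TimeLocal
open Summit.AtomisticToContinuum.HydrodynamicLimit.Theorems.ContactBalance (PathwiseBudget.regular
  PathwiseBudget.continuous_translate_T3)
open Literature.MathematicalPhysics.KineticTheory (hsDiameter)

noncomputable section

namespace EntropyBudget

variable {σ : ℝ} {N : ℕ}

/-! ## Free-flight calculus of a functional -/

/-- `deriv (r ↦ E(freeFlight r w)) r₀ = deriv (r ↦ E(freeFlight r (freeFlight r₀ w))) 0` (group property;
`deriv_comp_sub_const`, no differentiability needed). -/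
theorem deriv_flight_shift (E : Cfg N → ℝ) (w : Cfg N) (r₀ : ℝ) :
    deriv (fun s => E (freeFlight (Torus.geometry (Fin 3)) s w)) r₀ = deriv (fun s => E (freeFlight (Torus.geometry (Fin 3)) s (freeFlight (Torus.geometry (Fin 3)) r₀ w))) 0 := by
  set g : ℝ → ℝ := fun s' => E (freeFlight (Torus.geometry (Fin 3)) s' (freeFlight (Torus.geometry (Fin 3)) r₀ w)) with hg
  have e : (fun s => E (freeFlight (Torus.geometry (Fin 3)) s w)) = fun s => g (s - r₀) := by
    funext s
    simp only [hg, ← freeFlight_add, sub_add_cancel]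
  rw [e, deriv_comp_sub_const, sub_self]

/-- FTC ALONG ONE FREE FLIGHT: `E(freeFlight T w) − E(w) = ∫₀ᵀ (E ∘ freeFlight · w)'`. -/
theorem flight_ftc (E : Cfg N → ℝ) (hE : ∀ (w : Cfg N) (r : ℝ), DifferentiableAt ℝ (fun s => E (freeFlight (Torus.geometry (Fin 3)) s w)) r)
    (hB : ∀ w : Cfg N, ∃ B : ℝ, ∀ r, |deriv (fun s => E (freeFlight (Torus.geometry (Fin 3)) s w)) r| ≤ B) (w : Cfg N) (T : ℝ) :
    ∫ r in (0 : ℝ)..T, deriv (fun s => E (freeFlight (Torus.geometry (Fin 3)) s w)) r = E (freeFlight (Torus.geometry (Fin 3)) T w) - E w := by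
  obtain ⟨B, hBw⟩ := hB w
  -- the derivative is Borel (`measurable_deriv`) and bounded, hence interval integrable
  have hii : IntervalIntegrable (deriv fun s => E (freeFlight (Torus.geometry (Fin 3)) s w)) volume 0 T :=
    (intervalIntegrable_const (c := B)).mono_fun (measurable_deriv _).aestronglyMeasurable
      (ae_of_all _ fun r => by simpa [Real.norm_eq_abs] using (hBw r).trans (le_abs_self B))
  have h := intervalIntegral.integral_eq_sub_of_hasDerivAt (f := fun s => E (freeFlight (Torus.geometry (Fin 3)) s w))
    (fun r _ => (hE w r).hasDerivAt) hii
  rw [h, freeFlight_zero]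

/-! ## One stretch of a hard-sphere trajectory -/

/-- THE JUMP AT ONE COLLISION TIME: the contact-pair sum of `E(collidePair i j (γ t)) − E(γ t)` over `i < j` is
`E(leftLim γ t) − E(γ t)` (one ordered pair with `i < j`, pre-collisional configuration = left limit). -/
theorem sum_contactPairs_jump (hσ : 0 < σ) (hσ2 : σ < 2⁻¹) {γo : ℝ → Cfg N}
    (htraj : IsHardSphereTrajectory (Torus.geometry (Fin 3)) (hsDiameter σ N) (N + 1) γo) (E : Cfg N → ℝ) {t : ℝ}
    (ht : t ∈ collisionTimes (Torus.geometry (Fin 3)) (hsDiameter σ N) γo) :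
    ∑ p ∈ contactPairs (Torus.geometry (Fin 3)) (hsDiameter σ N) (γo t),
        (if p.1 < p.2 then E (collidePair (Torus.geometry (Fin 3)) p.1 p.2 (γo t)) - E (γo t) else 0) =
      E (Function.leftLim γo t) - E (γo t) := by
  have hG := PathwiseBudget.regular hσ hσ2 N
  obtain ⟨⟨p₀, q₀⟩, hpq₀⟩ := mem_collisionTimes_iff_contactPairs_nonempty.1 ht
  obtain ⟨p, q, hlt, hpq⟩ : ∃ p q : Fin (N + 1), p < q ∧
      (p, q) ∈ contactPairs (Torus.geometry (Fin 3)) (hsDiameter σ N) (γo t) := by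
    rcases lt_or_gt_of_ne (mem_contactPairs.1 hpq₀).1 with h | h
    · exact ⟨p₀, q₀, h, hpq₀⟩
    · exact ⟨q₀, p₀, h, (swap_mem_contactPairs_iff hG (p := (p₀, q₀))).2 hpq₀⟩
  have hne : (p, q) ≠ (q, p) := fun h => (ne_of_lt hlt) (Prod.mk.inj h).1
  rw [htraj.contactPairs_eq_pair hG hpq, Finset.sum_pair hne]
  simp only [if_pos hlt, if_neg (not_lt.2 hlt.le), add_zero]
  rw [htraj.leftLim_eq_collidePair (i := p) (j := q) (ne_of_lt hlt) (mem_contactPairs.1 hpq).2]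

/-- ONE STRETCH, EXACT. On a collision-free `(a, b)` the transport integrand is interval integrable on
`[a, b]` and `Σ_{(a,b]} jumps + E(γ b) − E(γ a) = ∫ₐᵇ d/dr|₀ E(freeFlight r (γ s)) ds`. -/
theorem stretch_eq (hσ : 0 < σ) (hσ2 : σ < 2⁻¹) {γo : ℝ → Cfg N}
    (htraj : IsHardSphereTrajectory (Torus.geometry (Fin 3)) (hsDiameter σ N) (N + 1) γo) (E : Cfg N → ℝ)
    (hE : ∀ (w : Cfg N) (r : ℝ), DifferentiableAt ℝ (fun s => E (freeFlight (Torus.geometry (Fin 3)) s w)) r)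
    (hB : ∀ w : Cfg N, ∃ B : ℝ, ∀ r, |deriv (fun s => E (freeFlight (Torus.geometry (Fin 3)) s w)) r| ≤ B)
    {g : ℝ → Fin (N + 1) → Fin (N + 1) → ℝ}
    (hg : ∀ t ∈ collisionTimes (Torus.geometry (Fin 3)) (hsDiameter σ N) γo,
      ∑ p ∈ contactPairs (Torus.geometry (Fin 3)) (hsDiameter σ N) (γo t), g t p.1 p.2 =
        E (Function.leftLim γo t) - E (γo t))
    {a b : ℝ} (hab : a ≤ b)
    (hfree : ∀ τ ∈ Ioo a b, τ ∉ collisionTimes (Torus.geometry (Fin 3)) (hsDiameter σ N) γo) :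
    IntervalIntegrable (fun s => deriv (fun r => E (freeFlight (Torus.geometry (Fin 3)) r (γo s))) 0) volume a b ∧
      collisionPairSum (Torus.geometry (Fin 3)) (hsDiameter σ N) γo (Ioc a b) g + E (γo b) - E (γo a) =
        ∫ s in a..b, deriv (fun r => E (freeFlight (Torus.geometry (Fin 3)) r (γo s))) 0 := by
  have hGc := PathwiseBudget.continuous_translate_T3 hσ hσ2 N
  -- the free-flight integrand and its integral
  set φ : ℝ → ℝ := fun r => E (freeFlight (Torus.geometry (Fin 3)) r (γo a)) with hφ
  obtain ⟨B, hBa⟩ := hB (γo a)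
  have hii0 : ∀ c d : ℝ, IntervalIntegrable (fun s => deriv φ (s - a)) volume c d := fun c d =>
    (intervalIntegrable_const (c := B)).mono_fun
      ((measurable_deriv φ).comp (measurable_id.sub_const a)).aestronglyMeasurable
      (ae_of_all _ fun r => by simpa [Real.norm_eq_abs] using (hBa (r - a)).trans (le_abs_self B))
  have hFF : ∀ s ∈ Ioo a b, γo s = freeFlight (Torus.geometry (Fin 3)) (s - a) (γo a) := fun s hs =>
    htraj.eq_freeFlight_of_Ioo_free hfree ⟨hs.1.le, hs.2⟩
  have hagree : ∀ s ∈ Ioo a b, deriv (fun r => E (freeFlight (Torus.geometry (Fin 3)) r (γo s))) 0 = deriv φ (s - a) := by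
    intro s hs
    rw [hFF s hs, hφ, deriv_flight_shift E (γo a) (s - a)]
  have hae : (fun s => deriv (fun r => E (freeFlight (Torus.geometry (Fin 3)) r (γo s))) 0) =ᵐ[volume.restrict (Ioc a b)] fun s => deriv φ (s - a) := by
    rw [EventuallyEq, ae_restrict_iff' measurableSet_Ioc]
    have hb : ∀ᵐ s ∂(volume : Measure ℝ), s ≠ b := ae_iff.2 (by simp)
    filter_upwards [hb] with s hsb hs
    exact hagree s ⟨hs.1, lt_of_le_of_ne hs.2 hsb⟩
  have hii : IntervalIntegrable (fun s => deriv (fun r => E (freeFlight (Torus.geometry (Fin 3)) r (γo s))) 0) volume a b := by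
    refine ⟨?_, ?_⟩
    · exact ((hii0 a b).1).congr_fun_ae hae.symm
    · rw [Ioc_eq_empty (not_lt.2 hab)]; exact integrableOn_empty
  refine ⟨hii, ?_⟩
  have hint : ∫ s in a..b, deriv (fun r => E (freeFlight (Torus.geometry (Fin 3)) r (γo s))) 0 = E (freeFlight (Torus.geometry (Fin 3)) (b - a) (γo a)) - E (γo a) := by
    rw [intervalIntegral.integral_of_le hab, integral_congr_ae hae, ← intervalIntegral.integral_of_le hab,
      intervalIntegral.integral_comp_sub_right (fun u => deriv φ u) a, sub_self, hφ, flight_ftc E hE hB]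
  rw [hint]
  rcases hab.eq_or_lt with rfl | hab'
  · rw [Set.Ioc_self, collisionPairSum_empty, sub_self, freeFlight_zero]; ring
  have hlim : Function.leftLim γo b = freeFlight (Torus.geometry (Fin 3)) (b - a) (γo a) := htraj.leftLim_eq_freeFlight hGc hab' hfree
  by_cases hbc : b ∈ collisionTimes (Torus.geometry (Fin 3)) (hsDiameter σ N) γo
  · have hset : collisionTimes (Torus.geometry (Fin 3)) (hsDiameter σ N) γo ∩ Ioc a b = {b} := by
      ext τ
      simp only [mem_inter_iff, mem_Ioc, mem_singleton_iff]
      refine ⟨fun h => ?_, fun h => ?_⟩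
      · by_contra hne
        exact hfree τ ⟨h.2.1, lt_of_le_of_ne h.2.2 hne⟩ h.1
      · subst h; exact ⟨hbc, hab', le_rfl⟩
    have hsum : collisionPairSum (Torus.geometry (Fin 3)) (hsDiameter σ N) γo (Ioc a b) g =
        E (Function.leftLim γo b) - E (γo b) := by
      rw [collisionPairSum, hset, finsum_mem_singleton, hg b hbc]
    rw [hsum, hlim]; ring
  · have hnoc : ∀ τ ∈ Ioc a b, τ ∉ collisionTimes (Torus.geometry (Fin 3)) (hsDiameter σ N) γo := by
      intro τ hτ
      rcases hτ.2.eq_or_lt with h | hlt'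
      · rw [h]; exact hbc
      · exact hfree τ ⟨hτ.1, hlt'⟩
    rw [collisionPairSum_eq_zero_of_forall_not_mem hnoc, htraj.free a b hab hnoc]; ring

/-! ## Telescoping along the trajectory -/

/-- **EXACT TELESCOPING** (strong induction on the number of collision times in `(0, t)`): the transport
integrand is interval integrable on `[0, t]` and
`Σ_{(0,t]} jumps + E(γ t) − E(γ 0) = ∫₀ᵗ d/dr|₀ E(freeFlight r (γ s)) ds`. -/
theorem telescope (hσ : 0 < σ) (hσ2 : σ < 2⁻¹) {γo : ℝ → Cfg N}
    (htraj : IsHardSphereTrajectory (Torus.geometry (Fin 3)) (hsDiameter σ N) (N + 1) γo) (E : Cfg N → ℝ)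
    (hE : ∀ (w : Cfg N) (r : ℝ), DifferentiableAt ℝ (fun s => E (freeFlight (Torus.geometry (Fin 3)) s w)) r)
    (hB : ∀ w : Cfg N, ∃ B : ℝ, ∀ r, |deriv (fun s => E (freeFlight (Torus.geometry (Fin 3)) s w)) r| ≤ B)
    {g : ℝ → Fin (N + 1) → Fin (N + 1) → ℝ}
    (hg : ∀ t ∈ collisionTimes (Torus.geometry (Fin 3)) (hsDiameter σ N) γo,
      ∑ p ∈ contactPairs (Torus.geometry (Fin 3)) (hsDiameter σ N) (γo t), g t p.1 p.2 =
        E (Function.leftLim γo t) - E (γo t)) :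
    ∀ (n : ℕ) (t : ℝ), 0 ≤ t →
      (collisionTimes (Torus.geometry (Fin 3)) (hsDiameter σ N) γo ∩ Ioo 0 t).ncard = n →
      IntervalIntegrable (fun s => deriv (fun r => E (freeFlight (Torus.geometry (Fin 3)) r (γo s))) 0) volume 0 t ∧
        collisionPairSum (Torus.geometry (Fin 3)) (hsDiameter σ N) γo (Ioc 0 t) g + E (γo t) - E (γo 0) =
          ∫ s in (0 : ℝ)..t, deriv (fun r => E (freeFlight (Torus.geometry (Fin 3)) r (γo s))) 0 := by
  intro n
  refine Nat.strong_induction_on n fun n ih => ?_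
  intro t ht hn
  by_cases hemp : collisionTimes (Torus.geometry (Fin 3)) (hsDiameter σ N) γo ∩ Ioo 0 t = ∅
  · have hfree : ∀ τ ∈ Ioo 0 t, τ ∉ collisionTimes (Torus.geometry (Fin 3)) (hsDiameter σ N) γo :=
      fun τ hτ hc => (Set.eq_empty_iff_forall_notMem.1 hemp τ) ⟨hc, hτ⟩
    exact stretch_eq hσ hσ2 htraj E hE hB hg ht hfree
  · have hfin : (collisionTimes (Torus.geometry (Fin 3)) (hsDiameter σ N) γo ∩ Ioo 0 t).Finite :=
      htraj.finite_collisionTimes_inter_of_subset_Icc Ioo_subset_Icc_self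
    obtain ⟨s, hs, hmax⟩ := Set.exists_max_image _ id hfin (Set.nonempty_iff_ne_empty.2 hemp)
    have hs0 : 0 < s := hs.2.1
    have hst : s < t := hs.2.2
    have hfree : ∀ τ ∈ Ioo s t, τ ∉ collisionTimes (Torus.geometry (Fin 3)) (hsDiameter σ N) γo :=
      fun τ hτ hc => (not_le.2 hτ.1) (hmax τ ⟨hc, hs0.trans hτ.1, hτ.2⟩)
    have hsub : collisionTimes (Torus.geometry (Fin 3)) (hsDiameter σ N) γo ∩ Ioo 0 s ⊂
        collisionTimes (Torus.geometry (Fin 3)) (hsDiameter σ N) γo ∩ Ioo 0 t := by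
      rw [Set.ssubset_def]
      exact ⟨fun τ hτ => ⟨hτ.1, hτ.2.1, hτ.2.2.trans hst⟩, fun h => (lt_irrefl s) (h hs).2.2⟩
    have hlt : (collisionTimes (Torus.geometry (Fin 3)) (hsDiameter σ N) γo ∩ Ioo 0 s).ncard < n :=
      (Set.ncard_lt_ncard hsub hfin).trans_eq hn
    obtain ⟨hii1, ih1⟩ := ih _ hlt s hs0.le rfl
    obtain ⟨hii2, hstr⟩ := stretch_eq hσ hσ2 htraj E hE hB hg hst.le hfree
    refine ⟨hii1.trans hii2, ?_⟩
    have hunion : collisionPairSum (Torus.geometry (Fin 3)) (hsDiameter σ N) γo (Ioc 0 t) g =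
        collisionPairSum (Torus.geometry (Fin 3)) (hsDiameter σ N) γo (Ioc 0 s) g +
          collisionPairSum (Torus.geometry (Fin 3)) (hsDiameter σ N) γo (Ioc s t) g := by
      rw [← Set.Ioc_union_Ioc_eq_Ioc hs0.le hst.le]
      exact collisionPairSum_union (htraj.finite_collisionTimes_inter_of_subset_Icc Ioc_subset_Icc_self)
        (htraj.finite_collisionTimes_inter_of_subset_Icc Ioc_subset_Icc_self) (Set.Ioc_disjoint_Ioc_of_le le_rfl) _
    rw [hunion, ← intervalIntegral.integral_add_adjacent_intervals hii1 hii2]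
    linarith

end EntropyBudget

/-- Registered anchor of this helper file (`--supports stmt-AtomisticToContinuum-14868`, helper of
`stub_entropyBudget`): the fundamental theorem of calculus along one free flight for a functional that is
differentiable along free flights with bounded derivative. -/
theorem bhEntropyBudget_identity_anchor : ∀ (N : ℕ) (E : Cfg N → ℝ), (∀ (w : Cfg N) (r : ℝ), DifferentiableAt ℝ (fun s => E (Literature.Analysis.FluidPDE.freeFlight (Literature.Analysis.FluidPDE.Torus.geometry (Fin 3)) s w)) r) → (∀ w : Cfg N, ∃ B : ℝ, ∀ r : ℝ, |deriv (fun s => E (Literature.Analysis.FluidPDE.freeFlight (Literature.Analysis.FluidPDE.Torus.geometry (Fin 3)) s w)) r| ≤ B) → ∀ (w : Cfg N) (T : ℝ), ∫ r in (0 : ℝ)..T, deriv (fun s => E (Literature.Analysis.FluidPDE.freeFlight (Literature.Analysis.FluidPDE.Torus.geometry (Fin 3)) s w)) r = E (Literature.Analysis.FluidPDE.freeFlight (Literature.Analysis.FluidPDE.Torus.geometry (Fin 3)) T w) - E w :=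
  fun _ E hE hB w T => EntropyBudget.flight_ftc E hE hB w T

end

end Summit.AtomisticToContinuum.HydrodynamicLimit.Theorems.BlockHDissipation
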